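import Literature.MathematicalPhysics.KineticTheory.HardSphereEulerLLN

/-!
# Mesoscopic LLN for local Gibbs states — VII a: Gaussian second moments

Helper file for item stmt-AtomisticToContinuum-9524 (`MesoscopicLLN`): Bienaymé on a finite
product of probability spaces (`integral_sq_sum_sub_pi`) and the conditional second moments of the
block momentum coordinates and block kinetic energy under the Maxwellian velocity law `velMeasure`
of a local Gibbs state (`integral_momCoord_sq`, `integral_energy_sq_le`). See file VII b
(`…VelocityBound`) for the resulting bound on the block fields.
-/

namespace Summit.AtomisticToContinuum.HydrodynamicLimit.Theorems.MesoLLN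

open MeasureTheory ProbabilityTheory Finset Filter Topology
open Literature.Probability.LatticeModels Literature.MathematicalPhysics.StatisticalMechanics
open Literature.MathematicalPhysics.KineticTheory
open Literature.Analysis.FluidPDE (Config)
open Literature.Analysis.FluidPDE.Torus (euclidDist reprSym)
open Literature.Analysis.FunctionSpaces (Torus.proj)
open scoped ENNReal

noncomputable section

/-! ### Bienaymé on a finite product -/

/-- **Second moment of an affine combination of independent variables** (finite product of
probability spaces): for `Xᵢ ∈ L²(μᵢ)`,
`∫ (∑ᵢ aᵢ Xᵢ(ωᵢ) - w)² d(⊗μ) = ∑ᵢ aᵢ² Var[Xᵢ] + (∑ᵢ aᵢ E[Xᵢ] - w)²`, and the integrand is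
integrable. -/
theorem integral_sq_sum_sub_pi {ι : Type*} [Fintype ι] {Ω : ι → Type*}
    [∀ i, MeasurableSpace (Ω i)] {μ : ∀ i, Measure (Ω i)} [∀ i, IsProbabilityMeasure (μ i)]
    {X : ∀ i, Ω i → ℝ} (hX : ∀ i, MemLp (X i) 2 (μ i)) (a : ι → ℝ) (w : ℝ) :
    Integrable (fun ω => (∑ i, a i * X i (ω i) - w) ^ 2) (Measure.pi μ) ∧
    ∫ ω, (∑ i, a i * X i (ω i) - w) ^ 2 ∂Measure.pi μ =
      ∑ i, a i ^ 2 * Var[X i; μ i] + (∑ i, a i * ∫ ω, X i ω ∂μ i - w) ^ 2 := by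
  set P := Measure.pi μ with hP
  -- the summands as functions on the product
  have hZi : ∀ i, MemLp (fun ω : ∀ i, Ω i => a i * X i (ω i)) 2 P := fun i =>
    ((hX i).const_mul (a i)).comp_measurePreserving (measurePreserving_eval μ i)
  have hZ : MemLp (fun ω : ∀ i, Ω i => ∑ i, a i * X i (ω i)) 2 P := memLp_finsetSum _ fun i _ => hZi i
  have hZw : MemLp (fun ω : ∀ i, Ω i => ∑ i, a i * X i (ω i) - w) 2 P := hZ.sub (memLp_const w)
  have hint : Integrable (fun ω => (∑ i, a i * X i (ω i) - w) ^ 2) P := hZw.integrable_sq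
  refine ⟨hint, ?_⟩
  -- means
  have hmean_i : ∀ i, ∫ ω, a i * X i (ω i) ∂P = a i * ∫ ω, X i ω ∂μ i := by
    intro i
    rw [integral_const_mul]
    congr 1
    have h := integral_map (μ := P) (measurable_pi_apply i).aemeasurable (f := X i)
      (by rw [(measurePreserving_eval μ i).map_eq]; exact (hX i).aestronglyMeasurable)
    rw [(measurePreserving_eval μ i).map_eq] at h
    exact h.symm
  have hmean : ∫ ω, (∑ i, a i * X i (ω i)) ∂P = ∑ i, a i * ∫ ω, X i ω ∂μ i := by
    rw [integral_finsetSum _ fun i _ => (hZi i).integrable one_le_two]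
    exact sum_congr rfl fun i _ => hmean_i i
  -- variance
  have hvar : Var[fun ω : ∀ i, Ω i => ∑ i, a i * X i (ω i); P] = ∑ i, a i ^ 2 * Var[X i; μ i] := by
    have hfun : (fun ω : ∀ i, Ω i => ∑ i, a i * X i (ω i)) = ∑ i, fun ω : ∀ i, Ω i => a i * X i (ω i) := by
      funext ω; simp [Finset.sum_apply]
    rw [hfun, hP, variance_sum_pi (X := fun i ω => a i * X i ω) fun i => (hX i).const_mul (a i)]
    exact sum_congr rfl fun i _ => variance_const_mul _ _ _
  -- second moment
  have hsq : ∫ ω, (∑ i, a i * X i (ω i)) ^ 2 ∂P =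
      ∑ i, a i ^ 2 * Var[X i; μ i] + (∑ i, a i * ∫ ω, X i ω ∂μ i) ^ 2 := by
    have h := variance_eq_sub hZ
    rw [hvar] at h
    have h2 : P[(fun ω : ∀ i, Ω i => ∑ i, a i * X i (ω i)) ^ 2] = ∫ ω, (∑ i, a i * X i (ω i)) ^ 2 ∂P := rfl
    rw [h2, hmean] at h
    linarith
  -- expand `(Z - w)² = Z² - 2wZ + w²`
  have hexp : ∀ ω : ∀ i, Ω i, (∑ i, a i * X i (ω i) - w) ^ 2 =
      (∑ i, a i * X i (ω i)) ^ 2 - 2 * w * (∑ i, a i * X i (ω i)) + w ^ 2 := fun ω => by ring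
  simp_rw [hexp]
  have hI1 : Integrable (fun ω => (∑ i, a i * X i (ω i)) ^ 2) P := hZ.integrable_sq
  have hI2 : Integrable (fun ω => 2 * w * ∑ i, a i * X i (ω i)) P :=
    (hZ.integrable one_le_two).const_mul _
  have hI12 : Integrable (fun ω => (∑ i, a i * X i (ω i)) ^ 2 - 2 * w * ∑ i, a i * X i (ω i)) P :=
    hI1.sub hI2
  rw [integral_add hI12 (integrable_const _), integral_sub hI1 hI2, integral_const_mul, hsq, hmean,
    integral_const, probReal_univ, one_smul]
  ring

/-! ### Gaussian velocities: momentum coordinates and kinetic energy -/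

variable {u₀ : T3 → V3} {θ₀ : T3 → ℝ}

/-- Pulling the normalisation into the sum. -/
theorem inv_mul_sum_mul {n : ℕ} (c : Fin n → ℝ) (f : Fin n → ℝ) (s : ℝ) :
    s * ∑ i, c i * f i = ∑ i, s * c i * f i := by
  rw [mul_sum]; exact sum_congr rfl fun i _ => by ring

/-- **Block momentum coordinate, conditional second moment**: under `⊗ᵢ N(u₀(yᵢ), θ₀(yᵢ))`,
`E (n⁻¹ ∑ cᵢ vᵢₗ - W)² = ∑ (n⁻¹cᵢ)² θ₀(yᵢ) + (n⁻¹ ∑ cᵢ u₀(yᵢ)ₗ - W)²`. -/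
theorem integral_momCoord_sq (hθ0 : ∀ x, 0 < θ₀ x) {n : ℕ} (y : Fin n → T3) (c : Fin n → ℝ)
    (W : ℝ) (l : Fin 3) :
    Integrable (fun v : Fin n → V3 => ((n : ℝ)⁻¹ * ∑ i, c i * v i l - W) ^ 2) (velMeasure u₀ θ₀ y) ∧
    ∫ v, ((n : ℝ)⁻¹ * ∑ i, c i * v i l - W) ^ 2 ∂velMeasure u₀ θ₀ y =
      ∑ i, ((n : ℝ)⁻¹ * c i) ^ 2 * θ₀ (y i) + ((n : ℝ)⁻¹ * ∑ i, c i * u₀ (y i) l - W) ^ 2 := by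
  have h := integral_sq_sum_sub_pi (μ := fun i => gaussMeasure (u₀ (y i)) (θ₀ (y i)))
    (X := fun i (v : V3) => v l) (fun i => memLp_coord_gaussMeasure _ _ l 2 (by simp))
    (fun i => (n : ℝ)⁻¹ * c i) W
  simp only [integral_coord_gaussMeasure _ (hθ0 _), variance_coord_gaussMeasure _ (hθ0 _).le] at h
  simp_rw [inv_mul_sum_mul]
  exact h

/-- **Block kinetic energy, conditional second moment (bound)**: under `⊗ᵢ N(u₀(yᵢ), θ₀(yᵢ))`,
`E (n⁻¹ ∑ cᵢ |vᵢ|²/2 - W)² ≤ ∑ (n⁻¹cᵢ)² Bᵢ + (n⁻¹ ∑ cᵢ (|u₀(yᵢ)|²/2 + 3θ₀(yᵢ)/2) - W)²` with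
`Bᵢ = 6 θ₀(yᵢ) |u₀(yᵢ)|² + θ₀(yᵢ)² K₄ / 2`. -/
theorem integral_energy_sq_le (hθ0 : ∀ x, 0 < θ₀ x) {n : ℕ} (y : Fin n → T3) (c : Fin n → ℝ)
    (W : ℝ) :
    Integrable (fun v : Fin n → V3 => ((n : ℝ)⁻¹ * ∑ i, c i * (‖v i‖ ^ 2 / 2) - W) ^ 2)
      (velMeasure u₀ θ₀ y) ∧
    ∫ v, ((n : ℝ)⁻¹ * ∑ i, c i * (‖v i‖ ^ 2 / 2) - W) ^ 2 ∂velMeasure u₀ θ₀ y ≤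
      ∑ i, ((n : ℝ)⁻¹ * c i) ^ 2 * (2 * 3 * θ₀ (y i) * ‖u₀ (y i)‖ ^ 2 +
        θ₀ (y i) ^ 2 / 2 * gaussFourthMomentConst (Fin 3)) +
      ((n : ℝ)⁻¹ * ∑ i, c i * (‖u₀ (y i)‖ ^ 2 / 2 + 3 / 2 * θ₀ (y i)) - W) ^ 2 := by
  have hmem : ∀ i, MemLp (fun v : V3 => ‖v‖ ^ 2 / 2) 2 (gaussMeasure (u₀ (y i)) (θ₀ (y i))) := by
    intro i
    have h := memLp_energy_gaussMeasure (u₀ (y i)) (θ₀ (y i)) 0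
    simp only [sub_zero] at h
    exact h
  have h := integral_sq_sum_sub_pi (μ := fun i => gaussMeasure (u₀ (y i)) (θ₀ (y i)))
    (X := fun i (v : V3) => ‖v‖ ^ 2 / 2) hmem (fun i => (n : ℝ)⁻¹ * c i) W
  -- the centred kinetic energy of the tree's Gaussian calculus
  have hcent : ∀ i, MemLp (fun v : V3 => ‖v‖ ^ 2 / 2 - ‖u₀ (y i)‖ ^ 2 / 2 -
      Fintype.card (Fin 3) * θ₀ (y i) / 2) 2 (gaussMeasure (u₀ (y i)) (θ₀ (y i))) := by
    intro i
    have h := memLp_energy_gaussMeasure (u₀ (y i)) (θ₀ (y i))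
      (‖u₀ (y i)‖ ^ 2 / 2 + Fintype.card (Fin 3) * θ₀ (y i) / 2)
    have hfun : (fun v : V3 => ‖v‖ ^ 2 / 2 - ‖u₀ (y i)‖ ^ 2 / 2 - Fintype.card (Fin 3) * θ₀ (y i) / 2) =
        fun v : V3 => ‖v‖ ^ 2 / 2 - (‖u₀ (y i)‖ ^ 2 / 2 + Fintype.card (Fin 3) * θ₀ (y i) / 2) := by
      funext v; ring
    rw [hfun]; exact h
  -- means
  have hmean : ∀ i, ∫ v, ‖v‖ ^ 2 / 2 ∂gaussMeasure (u₀ (y i)) (θ₀ (y i)) =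
      ‖u₀ (y i)‖ ^ 2 / 2 + 3 / 2 * θ₀ (y i) := by
    intro i
    have h0 := integral_energy_gaussMeasure (u₀ (y i)) (hθ0 (y i))
    have hint := (hcent i).integrable one_le_two
    have hfun : (fun v : V3 => ‖v‖ ^ 2 / 2) = fun v : V3 =>
        (‖v‖ ^ 2 / 2 - ‖u₀ (y i)‖ ^ 2 / 2 - Fintype.card (Fin 3) * θ₀ (y i) / 2) +
          (‖u₀ (y i)‖ ^ 2 / 2 + Fintype.card (Fin 3) * θ₀ (y i) / 2) := by
      funext v; ring
    rw [hfun, integral_add hint (integrable_const _), h0, integral_const, probReal_univ, one_smul,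
      zero_add, Fintype.card_fin]
    push_cast; ring
  -- variances
  have hvar : ∀ i, Var[fun v : V3 => ‖v‖ ^ 2 / 2; gaussMeasure (u₀ (y i)) (θ₀ (y i))] ≤
      2 * 3 * θ₀ (y i) * ‖u₀ (y i)‖ ^ 2 + θ₀ (y i) ^ 2 / 2 * gaussFourthMomentConst (Fin 3) := by
    intro i
    have hv1 : Var[fun v : V3 => ‖v‖ ^ 2 / 2; gaussMeasure (u₀ (y i)) (θ₀ (y i))] =
        Var[fun v : V3 => ‖v‖ ^ 2 / 2 - ‖u₀ (y i)‖ ^ 2 / 2 - Fintype.card (Fin 3) * θ₀ (y i) / 2;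
          gaussMeasure (u₀ (y i)) (θ₀ (y i))] := by
      have hfun : (fun v : V3 => ‖v‖ ^ 2 / 2 - ‖u₀ (y i)‖ ^ 2 / 2 - Fintype.card (Fin 3) * θ₀ (y i) / 2) =
          fun v : V3 => ‖v‖ ^ 2 / 2 - (‖u₀ (y i)‖ ^ 2 / 2 + Fintype.card (Fin 3) * θ₀ (y i) / 2) := by
        funext v; ring
      rw [hfun, variance_sub_const]
      exact (hmem i).aestronglyMeasurable
    rw [hv1, variance_eq_sub (hcent i), integral_energy_gaussMeasure _ (hθ0 _)]
    simp only [ne_eq, OfNat.ofNat_ne_zero, not_false_eq_true, zero_pow, sub_zero]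
    calc ∫ v, ((fun v : V3 => ‖v‖ ^ 2 / 2 - ‖u₀ (y i)‖ ^ 2 / 2 -
          Fintype.card (Fin 3) * θ₀ (y i) / 2) ^ 2) v ∂gaussMeasure (u₀ (y i)) (θ₀ (y i))
        = ∫ v, (‖v‖ ^ 2 / 2 - ‖u₀ (y i)‖ ^ 2 / 2 - Fintype.card (Fin 3) * θ₀ (y i) / 2) ^ 2
            ∂gaussMeasure (u₀ (y i)) (θ₀ (y i)) := rfl
      _ ≤ 2 * Fintype.card (Fin 3) * θ₀ (y i) * ‖u₀ (y i)‖ ^ 2 +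
            θ₀ (y i) ^ 2 / 2 * gaussFourthMomentConst (Fin 3) :=
          integral_energy_sq_gaussMeasure_le (u₀ (y i)) (hθ0 (y i))
      _ = 2 * 3 * θ₀ (y i) * ‖u₀ (y i)‖ ^ 2 + θ₀ (y i) ^ 2 / 2 * gaussFourthMomentConst (Fin 3) := by
          rw [Fintype.card_fin]; push_cast; ring
  -- assemble
  simp_rw [inv_mul_sum_mul] at h ⊢
  refine ⟨h.1, ?_⟩
  rw [show velMeasure u₀ θ₀ y = Measure.pi fun i => gaussMeasure (u₀ (y i)) (θ₀ (y i)) from rfl, h.2]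
  simp only [hmean]
  refine add_le_add (sum_le_sum fun i _ => mul_le_mul_of_nonneg_left (hvar i) (sq_nonneg _)) le_rfl

end

end Summit.AtomisticToContinuum.HydrodynamicLimit.Theorems.MesoLLN
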